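import Literature.NumberTheory.QuadraticForms.HilbertSymbolRegular
import Mathlib.LinearAlgebra.QuadraticForm.Basic
import Mathlib.LinearAlgebra.Matrix.BilinearForm
import Mathlib.LinearAlgebra.Matrix.Nondegenerate
import Mathlib.LinearAlgebra.BilinearForm.Orthogonal
import HarnessLib

/-!
# Quadratic forms of rank `≥ 5` over a field with regular Hilbert symbol represent zero

Topic `NumberTheory/QuadraticForms`; namespace `Literature.NumberTheory.QuadraticForms`. Everything
here is proved; pure field algebra on top of `HilbertSymbolRegular.lean`.

Serre, *A Course in Arithmetic*, Ch. IV §2.2 Thm 6: over `k = ℚ_p` a nondegenerate quadratic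
form of rank `4` with discriminant `d ≠ 1` represents `0` ((iii)), and every nondegenerate form
of rank `≥ 5` represents `0` ((iv)). We prove both over any field `F` whose Hilbert symbol is
bilinear and nondegenerate (`IsRegularHilbertField F`) and which has at least four square
classes — three elements `b, c, bc` none of which is a square — as `ℚ_p` does (`ℚ_p^*/ℚ_p^{*2}`
has order `4` or `8`, Ch. II §3.3); for `ℝ` (two square classes) (iv) is false.

* `exists_isotropic_of_rank_four` — **(iii), `d ≠ 1`**, for diagonal forms
  `b₀X₀² + b₁X₁² + b₂X₂² + b₃X₃²` with `b₀b₁b₂b₃` not a square: the sets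
  `A = {t : (t, -b₀b₁) = (b₀, b₁)} ∋ b₀` and `B = {t : (t, -b₂b₃) = (-b₂, -b₃)} ∋ -b₂` meet
  (Serre's lemma (c), `exists_hilbertSymbol_eq_and_eq`, since `(-b₀b₁)(-b₂b₃)` is not a square),
  and a common `t` is represented by `⟨b₀, b₁⟩` and by `⟨-b₂, -b₃⟩` (Cor. (ii),
  `exists_binary_eq_iff`), giving a zero — Serre's proof verbatim.
* `exists_ternary_eq` — **Cor. (iii) to Thm 6** (the part used): a ternary diagonal form
  `⟨c₀, c₁, c₂⟩` represents every `t ≠ 0` with `-t c₀c₁c₂` not a square (apply (iii) to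
  `⟨c₀, c₁, c₂, -t⟩`; an isotropic nondegenerate diagonal form represents everything,
  `exists_sum_mul_sq_eq_of_isotropic`, Ch. IV §1.6 Prop. 3').
* `exists_isotropic_of_rank_five` — **(iv)** for diagonal forms `⟨a₀, …, a₄⟩`: the binary form
  `⟨a₀, a₁⟩` represents some `t` outside the square class of `a₂a₃a₄` (`a₀`, `a₁`, or
  `a₀(u² + w²)` with `u² + w²` a non-square sum of two squares, which exists by
  `exists_sum_sq_not_isSquare` as soon as there are four square classes), and then
  `⟨-a₂, -a₃, -a₄⟩` represents `t` by the previous point. (Serre instead counts: "a form of rank 2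
  represents at least `2^{r-1}` elements of `k^*/k^{*2}`"; the count is replaced here by the
  explicit non-square sum of two squares.)
* `exists_isotropic_of_five_le` — (iv) for an arbitrary symmetric matrix `A ∈ Mₙ(F)`, `n ≥ 5`,
  `det A ≠ 0`: diagonalise (Mathlib `LinearMap.BilinForm.exists_orthogonal_basis`) and apply
  the diagonal case to the first five basis vectors.

## References

* J.-P. Serre, *A Course in Arithmetic*, GTM 7, Springer 1973, Ch. IV §1.6 Prop. 3', §2.2 Thm 6
  with its Lemma and Corollary (PDF pp. 31–32, 35–36). [Serre1973]
-/

namespace Literature.NumberTheory.QuadraticForms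

open Finset

variable {F : Type*} [Field F]

/-! ### Isotropic diagonal forms are universal -/

/-- **An isotropic nondegenerate diagonal form represents every element** (Serre, Ch. IV §1.6
Prop. 3': "If `f` represents `0` and is nondegenerate … `f` represents all elements of `k`").
For `f = ∑ cᵢ Xᵢ²` with all `cᵢ ≠ 0`, `2 ≠ 0`, and `f(x) = 0` with `x_j ≠ 0`:
`f(λ x + e_j) = 2 λ c_j x_j + c_j` takes the value `t` for `λ = (t - c_j)/(2 c_j x_j)`.
[cite: Serre1973, Ch. IV §1.6 Prop. 3'] -/
theorem exists_sum_mul_sq_eq_of_isotropic (h2 : (2 : F) ≠ 0) {k : ℕ} {c : Fin k → F}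
    (hc : ∀ i, c i ≠ 0) {x : Fin k → F} (hx0 : x ≠ 0) (hx : ∑ i, c i * x i ^ 2 = 0) (t : F) :
    ∃ y : Fin k → F, ∑ i, c i * y i ^ 2 = t := by
  obtain ⟨j, hj⟩ : ∃ j, x j ≠ 0 := Function.ne_iff.mp hx0
  set μ : F := (t - c j) / (2 * c j * x j) with hμ
  refine ⟨fun i => μ * x i + if i = j then 1 else 0, ?_⟩
  have hterm : ∀ i, c i * (μ * x i + if i = j then 1 else 0) ^ 2 =
      μ ^ 2 * (c i * x i ^ 2) + if i = j then 2 * μ * c j * x j + c j else 0 := by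
    intro i
    split_ifs with h
    · subst h; ring
    · ring
  simp_rw [hterm]
  rw [sum_add_distrib, ← mul_sum, hx, sum_ite_eq' univ j, if_pos (mem_univ j), mul_zero,
    zero_add, hμ]
  have hcj : c j ≠ 0 := hc j
  field_simp
  ring

/-! ### A non-square sum of two squares -/

/-- **A non-square sum of two squares.** If the Hilbert symbol of `F` is bilinear and `F` has
three non-squares `b, c, bc`, then some `u² + w² ≠ 0` is not a square. Otherwise: if `-1` is a
square every element is a sum of two squares, hence a square; if not, `(t, -1) = -1` for every
non-square `t` (a solution of `t x² - y² = 1` would make `t x² = y² + 1` a square), contradicting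
`(bc, -1) = (b, -1)(c, -1)`. (Replaces Serre's count of `k^*/k^{*2}` in Ch. IV §2.2 Thm 6 (iv).)
[folklore] -/
theorem exists_sum_sq_not_isSquare (hF : IsRegularHilbertField F)
    (hC : ∃ b c : F, ¬ IsSquare b ∧ ¬ IsSquare c ∧ ¬ IsSquare (b * c)) :
    ∃ u w : F, u ^ 2 + w ^ 2 ≠ 0 ∧ ¬ IsSquare (u ^ 2 + w ^ 2) := by
  by_contra H
  push Not at H
  have h2 := hF.two_ne_zero
  obtain ⟨b, c, hb, hc, hbc⟩ := hC
  have hb0 : b ≠ 0 := fun h => hb (h ▸ IsSquare.zero)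
  have hc0 : c ≠ 0 := fun h => hc (h ▸ IsSquare.zero)
  by_cases hm1 : IsSquare (-1 : F)
  · -- every element is a sum of two squares
    obtain ⟨i, hi⟩ := hm1
    have hb' : b = ((b + 1) / 2) ^ 2 + (i * ((b - 1) / 2)) ^ 2 := by
      have : i ^ 2 = -1 := by rw [sq]; exact hi.symm
      field_simp
      linear_combination (-(b - 1) ^ 2) * this
    exact hb (hb' ▸ H _ _ (hb' ▸ hb0))
  · -- `(t, -1) = -1` for every non-square `t`
    have key : ∀ t : F, ¬ IsSquare t → hilbertSymbol F t (-1) = -1 := by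
      intro t ht
      rw [hilbertSymbol_eq_neg_one_iff]
      rintro ⟨x, y, hxy⟩
      have hsum : t * x ^ 2 = y ^ 2 + 1 ^ 2 := by linear_combination hxy
      have hne : y ^ 2 + 1 ^ 2 ≠ 0 := fun h0 =>
        hm1 ⟨y, by linear_combination (-1 : F) * h0⟩
      have hx : x ≠ 0 := by
        rintro rfl
        exact hne (by rw [← hsum]; ring)
      obtain ⟨r, hr⟩ := H y 1 hne
      exact ht ⟨r / x, by field_simp; rw [hsum, hr]; ring⟩
    have := hF.mul_left b c (-1) hb0 hc0 (by simp)
    rw [key _ hbc, key _ hb, key _ hc] at this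
    norm_num at this

/-! ### Rank 4, discriminant not a square -/

/-- **Rank `4`, `d ≠ 1` (Serre, Ch. IV §2.2 Thm 6 (iii)).** Over a field with bilinear
nondegenerate Hilbert symbol, a diagonal form `b₀X₀² + b₁X₁² + b₂X₂² + b₃X₃²` (`bᵢ ≠ 0`) whose
discriminant `b₀b₁b₂b₃` is not a square represents zero. Serre's proof: a common element `t` of
`A = {t : (t, -b₀b₁) = (b₀,b₁)}` (`∋ b₀`) and `B = {t : (t, -b₂b₃) = (-b₂,-b₃)}` (`∋ -b₂`) exists
by the Lemma (c) since `b₀b₁b₂b₃` is not a square, and is represented by both `⟨b₀, b₁⟩` and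
`⟨-b₂, -b₃⟩` (Cor. (ii)). [cite: Serre1973, Ch. IV §2.2 Thm 6 (iii)] -/
theorem exists_isotropic_of_rank_four (hF : IsRegularHilbertField F) {b : Fin 4 → F}
    (hb : ∀ i, b i ≠ 0) (hd : ¬ IsSquare (b 0 * b 1 * b 2 * b 3)) :
    ∃ x : Fin 4 → F, x ≠ 0 ∧ ∑ i, b i * x i ^ 2 = 0 := by
  haveI : NeZero (2 : F) := ⟨hF.two_ne_zero⟩
  have hb2 : -b 2 ≠ 0 := neg_ne_zero.mpr (hb 2)
  have hb3 : -b 3 ≠ 0 := neg_ne_zero.mpr (hb 3)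
  -- `b₀ ∈ A`, `-b₂ ∈ B` (`(a, -ab) = (a, b)`, `hilbertSymbol_neg_mul_right`)
  have hA : ∃ t : F, t ≠ 0 ∧ hilbertSymbol F t (-(b 0 * b 1)) = hilbertSymbol F (b 0) (b 1) :=
    ⟨b 0, hb 0, hilbertSymbol_neg_mul_right (hb 0) (b 1)⟩
  have hB : ∃ t : F, t ≠ 0 ∧
      hilbertSymbol F t (-(-b 2 * -b 3)) = hilbertSymbol F (-b 2) (-b 3) :=
    ⟨-b 2, hb2, hilbertSymbol_neg_mul_right hb2 (-b 3)⟩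
  have hsq : ¬ IsSquare (-(b 0 * b 1) * -(-b 2 * -b 3)) := by
    rwa [show -(b 0 * b 1) * -(-b 2 * -b 3) = b 0 * b 1 * b 2 * b 3 by ring]
  obtain ⟨t, ht0, htA, htB⟩ := hF.exists_hilbertSymbol_eq_and_eq
    (neg_ne_zero.mpr (mul_ne_zero (hb 0) (hb 1))) (neg_ne_zero.mpr (mul_ne_zero hb2 hb3))
    hA hB hsq
  obtain ⟨x₀, x₁, hx⟩ := (hF.exists_binary_eq_iff (hb 0) (hb 1) ht0).mpr htA
  obtain ⟨y₀, y₁, hy⟩ := (hF.exists_binary_eq_iff hb2 hb3 ht0).mpr htB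
  refine ⟨![x₀, x₁, y₀, y₁], fun h0 => ht0 ?_, ?_⟩
  · have h00 : x₀ = 0 := by simpa using congr_fun h0 0
    have h01 : x₁ = 0 := by simpa using congr_fun h0 1
    rw [← hx, h00, h01]; ring
  · rw [Fin.sum_univ_four]
    simp only [Matrix.cons_val_zero, Matrix.cons_val_one, Matrix.cons_val]
    linear_combination hx - hy

/-! ### Ternary forms represent almost everything -/

/-- **Values of a ternary form** (Serre, Ch. IV §2.2, Cor. to Thm 6 (iii): `f` of rank `3`
represents `a` if `a ≠ -d`): over a field with bilinear nondegenerate Hilbert symbol, a diagonal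
form `c₀X₀² + c₁X₁² + c₂X₂²` (`cᵢ ≠ 0`) represents every `t ≠ 0` such that `-t c₀c₁c₂` is not a
square. Indeed `⟨c₀, c₁, c₂, -t⟩` has non-square discriminant, hence a zero `(x, z)`
(`exists_isotropic_of_rank_four`); if `z ≠ 0` then `f(x/z) = t`, and if `z = 0` then `f` is
isotropic and represents everything. [cite: Serre1973, Ch. IV §2.2 Cor. to Thm 6 (iii)] -/
theorem exists_ternary_eq (hF : IsRegularHilbertField F) {c : Fin 3 → F} (hc : ∀ i, c i ≠ 0)
    {t : F} (ht : t ≠ 0) (hd : ¬ IsSquare (c 0 * c 1 * c 2 * -t)) :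
    ∃ y : Fin 3 → F, ∑ i, c i * y i ^ 2 = t := by
  set b : Fin 4 → F := ![c 0, c 1, c 2, -t] with hbdef
  have hb : ∀ i, b i ≠ 0 := by
    intro i
    fin_cases i
    · exact hc 0
    · exact hc 1
    · exact hc 2
    · exact neg_ne_zero.mpr ht
  obtain ⟨x, hx0, hx⟩ := exists_isotropic_of_rank_four hF hb (by simpa [b] using hd)
  rw [Fin.sum_univ_four] at hx
  simp only [b, Matrix.cons_val_zero, Matrix.cons_val_one, Matrix.cons_val] at hx
  by_cases hz : x 3 = 0
  · -- `f` itself is isotropic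
    have hiso : ∑ i : Fin 3, c i * (x (Fin.castSucc i)) ^ 2 = 0 := by
      rw [Fin.sum_univ_three]
      simp only [Fin.castSucc_zero, Fin.castSucc_one]
      rw [show (Fin.castSucc (2 : Fin 3) : Fin 4) = 2 from rfl]
      linear_combination hx + (t * x 3) * hz
    have hne : (fun i : Fin 3 => x (Fin.castSucc i)) ≠ 0 := by
      intro h0
      apply hx0
      ext i
      fin_cases i
      · exact congr_fun h0 0
      · exact congr_fun h0 1
      · exact congr_fun h0 2
      · exact hz
    exact exists_sum_mul_sq_eq_of_isotropic hF.two_ne_zero hc hne hiso t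
  · refine ⟨fun i => x (Fin.castSucc i) / x 3, ?_⟩
    rw [Fin.sum_univ_three]
    simp only [Fin.castSucc_zero, Fin.castSucc_one]
    rw [show (Fin.castSucc (2 : Fin 3) : Fin 4) = 2 from rfl]
    field_simp
    linear_combination hx

/-! ### Rank 5 -/

/-- The binary form `⟨a₀, a₁⟩` represents an element outside any given square class `m F^{*2}`,
provided a non-square sum of two squares exists: `a₀` or `a₁` if one of `a₀ m`, `a₁ m` is not a
square, and otherwise `a₀ (u² + w²)` (then `a₁ = a₀ r²`). (The step "`f` represents at least one
element `a` distinct from `d`" of Serre's proof of Thm 6 (iv), Ch. IV §2.2.)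
[cite: Serre1973, Ch. IV §2.2 Thm 6 (iv)] -/
theorem exists_binary_value_not_isSquare {a₀ a₁ m : F} (ha₀ : a₀ ≠ 0) (ha₁ : a₁ ≠ 0) (hm : m ≠ 0)
    (hS : ∃ u w : F, u ^ 2 + w ^ 2 ≠ 0 ∧ ¬ IsSquare (u ^ 2 + w ^ 2)) :
    ∃ t : F, t ≠ 0 ∧ (∃ x y : F, a₀ * x ^ 2 + a₁ * y ^ 2 = t) ∧ ¬ IsSquare (t * m) := by
  by_cases h₀ : IsSquare (a₀ * m)
  · by_cases h₁ : IsSquare (a₁ * m)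
    · obtain ⟨u, w, hs0, hs⟩ := hS
      obtain ⟨p, hp⟩ := h₀
      obtain ⟨q, hq⟩ := h₁
      have hp0 : p ≠ 0 := fun h => mul_ne_zero ha₀ hm (by rw [hp, h, mul_zero])
      have hq0 : q ≠ 0 := fun h => mul_ne_zero ha₁ hm (by rw [hq, h, mul_zero])
      -- `a₁ = a₀ (q/p)²`
      have har : a₁ = a₀ * (q / p) ^ 2 := by
        field_simp
        have : a₁ * (a₀ * m) = a₀ * (a₁ * m) := by ring
        rw [hp, hq] at this
        linear_combination this
      refine ⟨a₀ * (u ^ 2 + w ^ 2), mul_ne_zero ha₀ hs0, ⟨u, w / (q / p), ?_⟩, fun hsq => hs ?_⟩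
      · rw [har]
        field_simp
      · -- `a₀ (u²+w²) m = p² (u²+w²)` is a square only if `u² + w²` is
        obtain ⟨r, hr⟩ := hsq
        refine ⟨r / p, ?_⟩
        field_simp
        have : a₀ * (u ^ 2 + w ^ 2) * m = (u ^ 2 + w ^ 2) * (a₀ * m) := by ring
        rw [this, hp] at hr
        linear_combination hr
    · exact ⟨a₁, ha₁, ⟨0, 1, by ring⟩, h₁⟩
  · exact ⟨a₀, ha₀, ⟨1, 0, by ring⟩, h₀⟩

/-- **Rank `5` (Serre, Ch. IV §2.2 Thm 6 (iv)).** Over a field with bilinear nondegenerate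
Hilbert symbol and three non-squares `b, c, bc`, every diagonal form `∑_{i<5} aᵢXᵢ²` with
`aᵢ ≠ 0` represents zero: `⟨a₀, a₁⟩` represents some `t` outside the square class of `a₂a₃a₄`
(`exists_binary_value_not_isSquare`), and then the ternary form `⟨-a₂, -a₃, -a₄⟩` represents `t`
(`exists_ternary_eq`), i.e. `a₀x₀² + a₁x₁² = t = -(a₂y₀² + a₃y₁² + a₄y₂²)`.
[cite: Serre1973, Ch. IV §2.2 Thm 6 (iv)] -/
theorem exists_isotropic_of_rank_five (hF : IsRegularHilbertField F)
    (hC : ∃ b c : F, ¬ IsSquare b ∧ ¬ IsSquare c ∧ ¬ IsSquare (b * c)) {a : Fin 5 → F}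
    (ha : ∀ i, a i ≠ 0) : ∃ x : Fin 5 → F, x ≠ 0 ∧ ∑ i, a i * x i ^ 2 = 0 := by
  have hm : a 2 * a 3 * a 4 ≠ 0 := mul_ne_zero (mul_ne_zero (ha 2) (ha 3)) (ha 4)
  obtain ⟨t, ht0, ⟨x₀, x₁, hx⟩, hts⟩ :=
    exists_binary_value_not_isSquare (ha 0) (ha 1) hm (exists_sum_sq_not_isSquare hF hC)
  -- `⟨-a₂, -a₃, -a₄⟩` represents `t`
  set c : Fin 3 → F := ![-a 2, -a 3, -a 4] with hcdef
  have hc : ∀ i, c i ≠ 0 := by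
    intro i
    fin_cases i
    · exact neg_ne_zero.mpr (ha 2)
    · exact neg_ne_zero.mpr (ha 3)
    · exact neg_ne_zero.mpr (ha 4)
  have hd : ¬ IsSquare (c 0 * c 1 * c 2 * -t) := by
    simp only [c, Matrix.cons_val_zero, Matrix.cons_val_one, Matrix.cons_val]
    rwa [show -a 2 * -a 3 * -a 4 * -t = t * (a 2 * a 3 * a 4) by ring]
  obtain ⟨y, hy⟩ := exists_ternary_eq hF hc ht0 hd
  rw [Fin.sum_univ_three] at hy
  simp only [c, Matrix.cons_val_zero, Matrix.cons_val_one, Matrix.cons_val] at hy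
  refine ⟨![x₀, x₁, y 0, y 1, y 2], fun h0 => ht0 ?_, ?_⟩
  · have h00 : x₀ = 0 := by simpa using congr_fun h0 0
    have h01 : x₁ = 0 := by simpa using congr_fun h0 1
    rw [← hx, h00, h01]; ring
  · rw [Fin.sum_univ_five]
    simp only [Matrix.cons_val_zero, Matrix.cons_val_one, Matrix.cons_val]
    linear_combination hx - hy

/-! ### Arbitrary nondegenerate forms of rank `≥ 5` -/

/-- **Every nondegenerate quadratic form of rank `≥ 5` represents zero** over a field `F` with
bilinear nondegenerate Hilbert symbol and three non-squares `b, c, bc` (Serre, *A Course in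
Arithmetic*, Ch. IV §2.2 Thm 6 (iv) for `F = ℚ_p`: "all forms in at least 5 variables represent
0"). For a symmetric `A ∈ Mₙ(F)`, `n ≥ 5`, `det A ≠ 0`: take an orthogonal basis `v` of `Fⁿ` for
`ᵗx A y` (Mathlib `exists_orthogonal_basis`, `2` being invertible); the squares `v_i.v_i` are
non-zero by nondegeneracy, and a zero `∑_{i<5} xᵢ vᵢ ≠ 0` of the diagonal form on the first
five basis vectors (`exists_isotropic_of_rank_five`) is a zero of `A`.
[cite: Serre1973, Ch. IV §2.2 Thm 6 (iv)] -/
theorem exists_isotropic_of_five_le (hF : IsRegularHilbertField F)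
    (hC : ∃ b c : F, ¬ IsSquare b ∧ ¬ IsSquare c ∧ ¬ IsSquare (b * c)) {n : ℕ}
    (A : Matrix (Fin n) (Fin n) F) (hn : 5 ≤ n) (hA : A.IsSymm) (hdet : A.det ≠ 0) :
    ∃ v : Fin n → F, v ≠ 0 ∧ Matrix.toBilin' A v v = 0 := by
  classical
  set B := Matrix.toBilin' A with hB
  have hBs : B.IsSymm := Matrix.isSymm_toBilin'_iff_isSymm.mpr hA
  have hBn : B.Nondegenerate := LinearMap.BilinForm.nondegenerate_toBilin'_of_det_ne_zero' A hdet
  haveI : Invertible (2 : F) := invertibleOfNonzero hF.two_ne_zero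
  obtain ⟨b, hb⟩ := LinearMap.BilinForm.exists_orthogonal_basis
    (LinearMap.BilinForm.isSymm_iff.mp hBs)
  have hb' : LinearMap.BilinForm.iIsOrtho B b := hb
  have hN : Module.finrank F (Fin n → F) = n := Module.finrank_fin_fun F
  -- the first five basis vectors and their squares
  let e : Fin 5 → Fin (Module.finrank F (Fin n → F)) := Fin.castLE (by omega)
  have he : Function.Injective e := Fin.castLE_injective _
  set a : Fin 5 → F := fun i => B (b (e i)) (b (e i)) with ha
  have ha0 : ∀ i, a i ≠ 0 := fun i => hb'.not_isOrtho_basis_self_of_nondegenerate hBn (e i)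
  obtain ⟨x, hx0, hx⟩ := exists_isotropic_of_rank_five hF hC ha0
  refine ⟨∑ i, x i • b (e i), fun h0 => hx0 ?_, ?_⟩
  · -- linear independence of `b ∘ e`
    have hli : LinearIndependent F (b ∘ e) := b.linearIndependent.comp e he
    funext i
    exact Fintype.linearIndependent_iff.mp hli x h0 i
  · -- orthogonality: `B (∑ xᵢ bᵢ) (∑ xⱼ bⱼ) = ∑ xᵢ² aᵢ`
    rw [LinearMap.BilinForm.sum_left]
    rw [← hx]
    refine Finset.sum_congr rfl fun i _ => ?_
    rw [LinearMap.BilinForm.sum_right, Finset.sum_eq_single i]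
    · rw [LinearMap.BilinForm.smul_left, LinearMap.BilinForm.smul_right, ha]
      ring
    · intro j _ hji
      rw [LinearMap.BilinForm.smul_left, LinearMap.BilinForm.smul_right]
      have : B (b (e i)) (b (e j)) = 0 :=
        LinearMap.BilinForm.iIsOrtho_def.mp hb' _ _ (fun h => hji (he h).symm)
      rw [this, mul_zero, mul_zero]
    · intro hi
      exact absurd (Finset.mem_univ i) hi

end Literature.NumberTheory.QuadraticForms
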